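import Summits.QuantumAdvantage.QuantumAdvantage.Theorems.HolonomyDialDecode

/-!
# HolonomyDial — Avoid (cell decomp-qadv, seat lens-2, generation 13; supports item 26531 `ExactnessDial.PolyLossOddU3`)

§A: the avoidance crux `HolAvoidLoss3`, residual `AvoidLift3`, `binPointerLoss3_of_holAvoidLoss3` (`avoidOfSep`), `holAvoidLoss3_of_polyLossOddU3` (head-2 bet `hdStrat`, exclusion table `dv0/dv1`, `rel_dev2_iff`, `hd_win`), `node_iff₂`, `closes₂`, `dial_chain`.

Split (≤ 400 lines, part 5/11) of the node file `HOME/decomp-qadv-lens-2/g13/HolonomyDial.lean` (v5, sha256 fb2c0281…,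
farm rc 0, no placeholders); declarations verbatim, namespace `Summit.QuantumAdvantage.QuantumAdvantage.Theorems.HolonomyDial`.
Record: NODE-g13.md.
-/

set_option linter.dupNamespace false

noncomputable section
open scoped Classical

namespace Summit.QuantumAdvantage.QuantumAdvantage.Theorems

open Finset
open Literature.Computability.QuantumComplexity Literature.Computability.QuantumComplexity.RingHLF
open Literature.Computability.MetaComplexity Literature.Computability.MetaComplexity.Smolensky
open Summit.QuantumAdvantage.AdviceFreeQNC0
open Summit.QuantumAdvantage.QuantumAdvantage.Theses (ExactnessDial.PolyLossOddU3 ExactnessDial.NoPerfectOdd3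
  ExactnessDial.NoPerfectConst3 ExactnessDial.MassStep3u ExactnessDial.OddToAll3 ExactnessDial.DPLift3
  ExactnessDial.MultiRingBridge3 ExactnessDial.closes)

namespace HolonomyDial

/-! ## §A The avoidance crux — task-dial level «AVOID» (every win certifies `hol(x) ≠ c(x)`)

A ring bet `z = t(x) ⊕ Dev` WINS iff `#{k ∈ Dev : g_k(x)}` is odd (`traceForm`), where `g_k(x) = [hol(x) + φ_k(x) ≢ 2]`
with the LOCAL phase `φ_k = k + W_k`. Summing over the three hypotheses `h` for `hol(x)`,
`Σ_h #{k ∈ Dev : h + φ_k ≢ 2} = 2·#Dev` is even, so at every winning input EXACTLY ONE hypothesis `c(x) ≠ hol(x)` is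
refuted by the bet: a win is a certificate `hol(x) ≠ c(x)`. For bets confined to the two root positions the certificate
is a polynomial of the same degree `+ O(1)` and conversely (`hdStrat`, exclusion table `dv0/dv1`), so
«2-position head strategies lose» ⟺ `HolAvoidLoss3`; the separation level (`BinPointerLoss3`, one steered stake) and
the decoding level (`HolDecodeLoss3`) sit below it. -/

section Avoid

variable {N : ℕ}

/-- piece `HolAvoidLoss3` [crux · NECESSARY (`holAvoidLoss3_of_polyLossOddU3`) · WEAKER-GENUINE (≡ 2-position head bets) ·
PROVED in v5 (§H `holAvoidLoss3`) · sits ABOVE the rungs `BinPointerLoss3` (`binPointerLoss3_of_holAvoidLoss3`) and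
`HolDecodeLoss3` (both PROVED)]:
no polylog-degree `𝔽₃` polynomial AVOIDS the holonomy trit on more than a `(1 - n^{-C})` fraction of the odd class. -/
def HolAvoidLoss3 : Prop :=
  ∃ C : ℕ, ∀ c : ℕ, ∃ n₀ : ℕ, ∀ n ≥ n₀, ∀ L : CubeFn (ZMod 3) n,
    L ∈ lowDeg (ZMod 3) n ((Nat.log 2 n) ^ c) →
      ((univ.filter fun x : Fin n → Bool => OddZeros x ∧ L x ≠ ((hol x : ℕ) : ZMod 3)).card : ℝ) ≤
        (1 - 1 / (n : ℝ) ^ C) * (2 : ℝ) ^ (n - 1)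

/-- piece `AvoidLift3` [DECLARED RESIDUAL ≡ T mod `HolAvoidLoss3`; since v5 (`holAvoidLoss3`) it is ≡ T OUTRIGHT
(`polyLossOddU3_iff_avoidLift3`) · UNDECIDED · IDEA-NEEDED]: «a polylog bet anywhere on the
ring yields a polylog certificate» — the refuted hypothesis `c(x)` of a general winning bet involves the phases `φ_k`
far from the root, which are NOT low-degree; rotation-covariance (LeaderDial `symLaw3`) is the natural first move. -/
def AvoidLift3 : Prop := HolAvoidLoss3 → ExactnessDial.PolyLossOddU3

/-! ### polynomial gadgets at the root -/

/-- Ring-game helper `const_mem_lowDeg` (lens-2 law package; see the module docstring). -/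
theorem const_mem_lowDeg (a : ZMod 3) (D : ℕ) : (fun _ : Fin N → Bool => a) ∈ lowDeg (ZMod 3) N D := by
  have e : (fun _ : Fin N → Bool => a) = a • (1 : CubeFn (ZMod 3) N) := by
    funext x; simp
  rw [e]; exact Submodule.smul_mem _ _ (one_mem_lowDeg D)

/-- `[L = a]` as a polynomial: `1 - (L - a)²`. -/
def indP (L : CubeFn (ZMod 3) N) (a : ZMod 3) : CubeFn (ZMod 3) N :=
  1 - (L - fun _ => a) * (L - fun _ => a)

/-- Ring-game helper `indP_mem` (lens-2 law package; see the module docstring). -/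
theorem indP_mem {D : ℕ} {L : CubeFn (ZMod 3) N} (hL : L ∈ lowDeg (ZMod 3) N D) (a : ZMod 3) :
    indP L a ∈ lowDeg (ZMod 3) N (D + D) := by
  have h1 : (L - fun _ => a) ∈ lowDeg (ZMod 3) N D := Submodule.sub_mem _ hL (const_mem_lowDeg a D)
  exact Submodule.sub_mem _ (one_mem_lowDeg _) (mul_mem_lowDeg_add h1 h1)

/-- Ring-game helper `indP_apply` (lens-2 law package; see the module docstring). -/
theorem indP_apply (L : CubeFn (ZMod 3) N) (a : ZMod 3) (x : Fin N → Bool) :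
    indP L a x = if L x = a then 1 else 0 := by
  simp only [indP, Pi.sub_apply, Pi.mul_apply, Pi.one_apply]
  generalize L x = v
  revert v; revert a; decide

/-- `u_0 = [x_0 = 0]` as the polynomial `1 - x_0`. -/
def u0P (hN : 0 < N) : CubeFn (ZMod 3) N := 1 - mono (ZMod 3) {(⟨0, hN⟩ : Fin N)}

/-- Ring-game helper `u0P_mem` (lens-2 law package; see the module docstring). -/
theorem u0P_mem (hN : 0 < N) {D : ℕ} (hD : 1 ≤ D) : u0P hN ∈ lowDeg (ZMod 3) N D :=
  Submodule.sub_mem _ (one_mem_lowDeg D) (mono_mem_lowDeg (by rw [card_singleton]; exact hD))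

/-- Ring-game helper `u0P_apply` (lens-2 law package; see the module docstring). -/
theorem u0P_apply (hN : 0 < N) (x : Fin N → Bool) :
    u0P hN x = if x ⟨0, hN⟩ = false then 1 else 0 := by
  simp only [u0P, Pi.sub_apply, Pi.one_apply, mono_singleton_apply]
  cases x ⟨0, hN⟩ <;> simp

/-- Ring-game helper `uCoord_zero` (lens-2 law package; see the module docstring). -/
theorem uCoord_zero (x : Fin N → Bool) (hN : 0 < N) : uCoord x ⟨0, hN⟩ = !x ⟨0, hN⟩ := by
  rw [uCoord_eq_zpar]
  show zpar x (0 + 1) = _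
  rw [zpar_succ x hN, zpar_zero, Bool.false_xor]

/-- `W_1 = u_0 = [x_0 = 0]`. -/
theorem Wk_one_eq (x : Fin N → Bool) (hN : 0 < N) : Wk x 1 = if x ⟨0, hN⟩ = false then 1 else 0 := by
  have h := Wk_succ x (k := 0) hN
  simp only [Wk_zero, zero_add, uCoord_zero] at h
  rw [h]
  cases x ⟨0, hN⟩ <;> simp

/-- `g_0 ⟺ hol ≠ 2`. -/
theorem gCond_zero_iff' (x : Fin N → Bool) : gCond x 0 ↔ hol x ≠ 2 := by
  unfold gCond hol Wtot
  rw [Wk_zero]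
  constructor <;> intro h <;> omega

/-- `g_1 ⟺ hol ≢ 1 - u_0`. -/
theorem gCond_one_iff' (x : Fin N → Bool) (hN : 0 < N) :
    gCond x 1 ↔ (1 + (if x ⟨0, hN⟩ = false then 1 else 0) + hol x) % 3 ≠ 2 := by
  unfold gCond hol Wtot
  rw [Wk_one_eq x hN]
  cases x ⟨0, hN⟩ <;> simp <;> omega

/-! ### AVOID ⟹ SEPARATE: the separator's refuted hypothesis -/

/-- the avoider read off a {0,1}-pointer: `f = 1 ↦ 2`, `f ≠ 1 ↦ 1 - u_0`. -/
def avoidOfSep (hN : 0 < N) (f : CubeFn (ZMod 3) N) : CubeFn (ZMod 3) N :=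
  selP f + selP f + (1 - u0P hN) * (1 - selP f)

/-- Ring-game helper `avoidOfSep_mem` (lens-2 law package; see the module docstring). -/
theorem avoidOfSep_mem (hN : 0 < N) {D : ℕ} {f : CubeFn (ZMod 3) N} (hf : f ∈ lowDeg (ZMod 3) N D) :
    avoidOfSep hN f ∈ lowDeg (ZMod 3) N (1 + (D + D)) := by
  unfold avoidOfSep
  have hs := selP_mem hf
  refine Submodule.add_mem _ (Submodule.add_mem _ (lowDeg_mono (by omega) hs) (lowDeg_mono (by omega) hs)) ?_
  exact mul_mem_lowDeg_add (Submodule.sub_mem _ (one_mem_lowDeg 1) (u0P_mem hN le_rfl))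
    (Submodule.sub_mem _ (one_mem_lowDeg _) hs)

/-- Ring-game helper `avoidOfSep_apply` (lens-2 law package; see the module docstring). -/
theorem avoidOfSep_apply (hN : 0 < N) (f : CubeFn (ZMod 3) N) (x : Fin N → Bool) :
    avoidOfSep hN f x = if f x = 1 then 2 else if x ⟨0, hN⟩ = false then 0 else 1 := by
  simp only [avoidOfSep, Pi.add_apply, Pi.mul_apply, Pi.sub_apply, Pi.one_apply, selP_apply, u0P_apply]
  by_cases h : f x = 1 <;> cases x ⟨0, hN⟩ <;> simp [h]
  all_goals decide

/-- a winning {0,1}-pointer refutes one holonomy hypothesis by a polynomial of the same degree `+1`. -/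
theorem avoid_of_binPtrWin (hN : 0 < N) (f : CubeFn (ZMod 3) N) (x : Fin N → Bool) (hw : BinPtrWin f x) :
    avoidOfSep hN f x ≠ ((hol x : ℕ) : ZMod 3) := by
  rw [avoidOfSep_apply]
  obtain ⟨h1, h2⟩ := hw
  rw [gCond_zero_iff'] at h1
  rw [gCond_one_iff' x hN] at h2
  have hlt : hol x < 3 := Nat.mod_lt _ (by norm_num)
  generalize hol x = h at h1 h2 hlt ⊢
  by_cases hf : f x = 1
  · rw [if_pos hf]
    have h1' := h1 hf
    clear h1 h2
    revert h1' hlt h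
    decide
  · rw [if_neg hf]
    have h2' := h2 hf
    clear h1 h2
    revert h2'
    generalize x ⟨0, hN⟩ = u
    revert u hlt h
    decide

/-- **LAW (dial, down one level)**: `HolAvoidLoss3 → BinPointerLoss3`. -/
theorem binPointerLoss3_of_holAvoidLoss3 (h : HolAvoidLoss3) : BinPointerLoss3 := by
  obtain ⟨C, hC⟩ := h
  refine ⟨C, fun c => ?_⟩
  obtain ⟨n₀, hn₀⟩ := hC (c + 1)
  refine ⟨max n₀ 16, fun n hn f hf => ?_⟩
  have hn16 : 16 ≤ n := le_of_max_le_right hn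
  have h0n : 0 < n := by omega
  have hLmem : avoidOfSep h0n f ∈ lowDeg (ZMod 3) n ((Nat.log 2 n) ^ (c + 1)) :=
    lowDeg_mono (le_trans (by omega) (deg_bump n c hn16)) (avoidOfSep_mem h0n hf)
  have hle := hn₀ n (le_of_max_le_left hn) (avoidOfSep h0n f) hLmem
  refine le_trans ?_ hle
  exact_mod_cast card_le_card fun x hx => by
    rw [mem_filter] at hx ⊢
    exact ⟨hx.1, hx.2.1, avoid_of_binPtrWin h0n f x hx.2.2⟩

/-! ### WIN ⟹ AVOID: the head-2 bet steered by an avoider (exclusion table) -/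

/-- exclusion table: to refute hypothesis `c`, deviate at the root position iff `dv0 c u_0` … -/
def dv0 (c : ZMod 3) (u : Bool) : Bool := decide (c = 2) || (decide (c = 1) && u) || (decide (c = 0) && !u)

/-- … and at position `1` iff `dv1 c`. -/
def dv1 (c : ZMod 3) : Bool := !decide (c = 2)

/-- Ring-game helper `hdDev0` (lens-2 law package; see the module docstring). -/
def hdDev0 (hN : 0 < N) (L : CubeFn (ZMod 3) N) : CubeFn (ZMod 3) N :=
  indP L 2 + indP L 1 * u0P hN + indP L 0 * (1 - u0P hN)

/-- Ring-game helper `hdDev1` (lens-2 law package; see the module docstring). -/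
def hdDev1 (L : CubeFn (ZMod 3) N) : CubeFn (ZMod 3) N := 1 - indP L 2

/-- Ring-game helper `hdDev0_mem` (lens-2 law package; see the module docstring). -/
theorem hdDev0_mem (hN : 0 < N) {D : ℕ} {L : CubeFn (ZMod 3) N} (hL : L ∈ lowDeg (ZMod 3) N D) :
    hdDev0 hN L ∈ lowDeg (ZMod 3) N (D + D + 1) := by
  unfold hdDev0
  refine Submodule.add_mem _ (Submodule.add_mem _ (lowDeg_mono (by omega) (indP_mem hL 2)) ?_) ?_
  · exact mul_mem_lowDeg_add (indP_mem hL 1) (u0P_mem hN le_rfl)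
  · exact mul_mem_lowDeg_add (indP_mem hL 0) (Submodule.sub_mem _ (one_mem_lowDeg 1) (u0P_mem hN le_rfl))

/-- Ring-game helper `hdDev1_mem` (lens-2 law package; see the module docstring). -/
theorem hdDev1_mem {D : ℕ} {L : CubeFn (ZMod 3) N} (hL : L ∈ lowDeg (ZMod 3) N D) :
    hdDev1 L ∈ lowDeg (ZMod 3) N (D + D) :=
  Submodule.sub_mem _ (one_mem_lowDeg _) (indP_mem hL 2)

/-- Ring-game helper `hdDev0_apply` (lens-2 law package; see the module docstring). -/
theorem hdDev0_apply (hN : 0 < N) (L : CubeFn (ZMod 3) N) (x : Fin N → Bool) :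
    hdDev0 hN L x = if dv0 (L x) (decide (x ⟨0, hN⟩ = false)) then 1 else 0 := by
  simp only [hdDev0, Pi.add_apply, Pi.mul_apply, Pi.sub_apply, Pi.one_apply, indP_apply, u0P_apply, dv0]
  generalize L x = c
  generalize x ⟨0, hN⟩ = b
  revert c; revert b; decide

/-- Ring-game helper `hdDev1_apply` (lens-2 law package; see the module docstring). -/
theorem hdDev1_apply (L : CubeFn (ZMod 3) N) (x : Fin N → Bool) :
    hdDev1 L x = if dv1 (L x) then 1 else 0 := by
  simp only [hdDev1, Pi.sub_apply, Pi.one_apply, indP_apply, dv1]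
  generalize L x = c
  revert c; decide

/-- **the head-2 bet steered by `L`**: deviate from the canonical guess at positions `0`/`1` per the exclusion table. -/
def hdStrat (hN : 0 < N) (L : CubeFn (ZMod 3) N) (i : Fin N) : CubeFn (ZMod 3) N :=
  if i.val = 0 then xorP (tPoly i) (hdDev0 hN L)
  else if i.val = 1 then xorP (tPoly i) (hdDev1 L)
  else tPoly i

/-- Ring-game helper `hdStrat_mem` (lens-2 law package; see the module docstring). -/
theorem hdStrat_mem (hN : 0 < N) {D : ℕ} {L : CubeFn (ZMod 3) N} (hL : L ∈ lowDeg (ZMod 3) N D) (i : Fin N) :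
    hdStrat hN L i ∈ lowDeg (ZMod 3) N (2 + (D + D + 1)) := by
  unfold hdStrat
  split_ifs
  · exact xorP_mem (tPoly_mem i) (hdDev0_mem hN hL)
  · exact lowDeg_mono (by omega) (xorP_mem (tPoly_mem i) (hdDev1_mem hL))
  · exact lowDeg_mono (by omega) (tPoly_mem i)

/-- Ring-game helper `hdStrat_out` (lens-2 law package; see the module docstring). -/
theorem hdStrat_out (hN : 0 < N) (L : CubeFn (ZMod 3) N) (i : Fin N) (x : Fin N → Bool) :
    decide (hdStrat hN L i x = 1) =
      xor (tGuess x i) (if i.val = 0 then dv0 (L x) (decide (x ⟨0, hN⟩ = false))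
        else if i.val = 1 then dv1 (L x) else false) := by
  have h0 := hdDev0_apply hN L x
  have h1 := hdDev1_apply L x
  unfold hdStrat
  split_ifs with hi0 hi1
  · rw [xorP_apply_bool _ _ x _ _ (tPoly_apply i x) h0]
    cases xor (tGuess x i) (dv0 (L x) (decide (x ⟨0, hN⟩ = false))) <;> decide
  · rw [xorP_apply_bool _ _ x _ _ (tPoly_apply i x) h1]
    cases xor (tGuess x i) (dv1 (L x)) <;> decide
  · rw [tPoly_apply]
    cases tGuess x i <;> decide

/-- **trace form for bets at the two root positions**: with deviations `p` at `0` and `q` at `1` (and none elsewhere),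
`Rel ⟺ [p ∧ g_0] ⊕ [q ∧ g_1]`. -/
theorem rel_dev2_iff (hN : 3 ≤ N) (x : Fin N → Bool) (hx : OddZeros x) (p q : Bool) (z : Fin N → Bool)
    (hz : ∀ k : Fin N, z k = xor (tGuess x k) (if k.val = 0 then p else if k.val = 1 then q else false)) :
    Rel x z ↔ xor (p && decide (gCond x 0)) (q && decide (gCond x 1)) = true := by
  rw [traceForm hN x hx]
  have h0N : 0 < N := by omega
  have h1N : 1 < N := by omega
  set S := univ.filter fun k : Fin N =>
      xor (z k) (tGuess x k) = true ∧ (k.val + N + Wk x k.val + Wk x (N - 1)) % 3 ≠ 2 with hS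
  have hmem : ∀ k : Fin N, k ∈ S ↔
      (k.val = 0 ∧ (p = true ∧ gCond x 0)) ∨ (k.val = 1 ∧ (q = true ∧ gCond x 1)) := by
    intro k
    rw [hS, mem_filter, hz k]
    simp only [mem_univ, true_and, gCond]
    by_cases hk0 : k.val = 0
    · simp only [hk0, if_true]
      cases tGuess x k <;> cases p <;> simp
    · by_cases hk1 : k.val = 1
      · simp only [hk1]
        cases tGuess x k <;> cases q <;> simp
      · simp only [hk0, hk1, if_false]
        cases tGuess x k <;> simp
  have hSeq : S = (if p = true ∧ gCond x 0 then {(⟨0, h0N⟩ : Fin N)} else ∅) ∪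
      (if q = true ∧ gCond x 1 then {(⟨1, h1N⟩ : Fin N)} else ∅) := by
    ext k
    rw [hmem, mem_union]
    constructor
    · rintro (⟨hk, hA⟩ | ⟨hk, hB⟩)
      · left; rw [if_pos hA, mem_singleton, Fin.ext_iff]; exact hk
      · right; rw [if_pos hB, mem_singleton, Fin.ext_iff]; exact hk
    · rintro (h | h)
      · by_cases hA : p = true ∧ gCond x 0
        · rw [if_pos hA, mem_singleton, Fin.ext_iff] at h; exact Or.inl ⟨h, hA⟩
        · rw [if_neg hA] at h; exact absurd h (Finset.notMem_empty _)
      · by_cases hB : q = true ∧ gCond x 1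
        · rw [if_pos hB, mem_singleton, Fin.ext_iff] at h; exact Or.inr ⟨h, hB⟩
        · rw [if_neg hB] at h; exact absurd h (Finset.notMem_empty _)
  rw [hSeq]
  have hd : Disjoint ({(⟨0, h0N⟩ : Fin N)} : Finset (Fin N)) {(⟨1, h1N⟩ : Fin N)} := by
    rw [Finset.disjoint_singleton_left, mem_singleton, Fin.ext_iff]; simp
  have nA : ¬ (p = true ∧ gCond x 0) → (p && decide (gCond x 0)) = false := by
    intro hA; cases p
    · rfl
    · simp only [Bool.true_and, decide_eq_false_iff_not]; exact fun h => hA ⟨rfl, h⟩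
  have nB : ¬ (q = true ∧ gCond x 1) → (q && decide (gCond x 1)) = false := by
    intro hB; cases q
    · rfl
    · simp only [Bool.true_and, decide_eq_false_iff_not]; exact fun h => hB ⟨rfl, h⟩
  by_cases hA : p = true ∧ gCond x 0 <;> by_cases hB : q = true ∧ gCond x 1
  · rw [if_pos hA, if_pos hB, Finset.card_union_of_disjoint hd, card_singleton, card_singleton]
    obtain ⟨hp, hg0⟩ := hA
    obtain ⟨hq, hg1⟩ := hB
    simp [hp, hq, hg0, hg1]
  · rw [if_pos hA, if_neg hB, Finset.union_empty, card_singleton]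
    obtain ⟨hp, hg0⟩ := hA
    simp [hp, hg0, nB hB]
  · rw [if_neg hA, if_pos hB, Finset.empty_union, card_singleton]
    obtain ⟨hq, hg1⟩ := hB
    simp [hq, hg1, nA hA]
  · rw [if_neg hA, if_neg hB, Finset.union_empty, card_empty]
    simp [nA hA, nB hB]

/-- **LAW (exclusion table)**: if `L` avoids the holonomy at an odd `x`, the head-2 bet steered by `L` wins at `x`. -/
theorem hd_win (hN : 3 ≤ N) (h0 : 0 < N) (L : CubeFn (ZMod 3) N) (x : Fin N → Bool) (hx : OddZeros x)
    (hL : L x ≠ ((hol x : ℕ) : ZMod 3)) : Rel x (fun i => decide (hdStrat h0 L i x = 1)) := by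
  rw [rel_dev2_iff hN x hx (dv0 (L x) (decide (x ⟨0, h0⟩ = false))) (dv1 (L x)) _
    (fun k => hdStrat_out h0 L k x)]
  have hg0 : decide (gCond x 0) = !decide (hol x = 2) := by
    rw [gCond_zero_iff']
    by_cases h : hol x = 2 <;> simp [h]
  have hg1 : decide (gCond x 1) = !decide ((1 + (if x ⟨0, h0⟩ = false then 1 else 0) + hol x) % 3 = 2) := by
    rw [gCond_one_iff' x h0]
    by_cases h : (1 + (if x ⟨0, h0⟩ = false then 1 else 0) + hol x) % 3 = 2 <;> simp [h]
  rw [hg0, hg1]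
  have hlt : hol x < 3 := Nat.mod_lt _ (by norm_num)
  generalize hol x = h at hL hlt ⊢
  generalize L x = c at hL ⊢
  generalize x ⟨0, h0⟩ = u
  revert u hL c hlt h
  decide

/-- `32 ≤ n → 5 ≤ log₂ n`. -/
theorem five_le_log (n : ℕ) (hn : 32 ≤ n) : 5 ≤ Nat.log 2 n := by
  rw [show (32 : ℕ) = 2 ^ 5 by norm_num] at hn
  exact Nat.le_log_of_pow_le (by norm_num) hn

/-- Ring-game helper `deg_bump3` (lens-2 law package; see the module docstring). -/
theorem deg_bump3 (n c : ℕ) (hn : 32 ≤ n) :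
    2 + ((Nat.log 2 n) ^ c + (Nat.log 2 n) ^ c + 1) ≤ (Nat.log 2 n) ^ (c + 1) := by
  have hL := five_le_log n hn
  have hpos : 1 ≤ (Nat.log 2 n) ^ c := Nat.one_le_pow _ _ (by omega)
  rw [pow_succ]
  nlinarith

/-- **NECESSITY of the crux**: `PolyLossOddU3 → HolAvoidLoss3` (the avoider steers a winning head-2 bet of degree `2D+3`). -/
theorem holAvoidLoss3_of_polyLossOddU3 (h : ExactnessDial.PolyLossOddU3) : HolAvoidLoss3 := by
  obtain ⟨C, hC⟩ := h
  refine ⟨C, fun c => ?_⟩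
  obtain ⟨n₀, hn₀⟩ := hC (c + 1)
  refine ⟨max n₀ 32, fun n hn L hL => ?_⟩
  have hn32 : 32 ≤ n := le_of_max_le_right hn
  have h0n : 0 < n := by omega
  have hP : ∀ i, hdStrat h0n L i ∈ lowDeg (ZMod 3) n ((Nat.log 2 n) ^ (c + 1)) := fun i =>
    lowDeg_mono (deg_bump3 n c hn32) (hdStrat_mem h0n hL i)
  have hle := hn₀ n (le_of_max_le_left hn) (hdStrat h0n L) hP
  refine le_trans ?_ hle
  exact_mod_cast card_le_card fun x hx => by
    rw [mem_filter] at hx ⊢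
    exact ⟨hx.1, hx.2.1, hd_win (by omega) h0n L x hx.2.1 hx.2.2⟩

/-! ### node equation at the AVOID level -/

/-- **node kernel identity (v3)**: `T ⟺ HolAvoidLoss3 ∧ AvoidLift3`. -/
theorem node_iff₂ : ExactnessDial.PolyLossOddU3 ↔ HolAvoidLoss3 ∧ AvoidLift3 :=
  ⟨fun h => ⟨holAvoidLoss3_of_polyLossOddU3 h, fun _ => h⟩, fun h => h.2 h.1⟩

/-- **`closes₂`**: the AVOID-level pieces and the cone's open `DPLift3` give the leaf `AdviceFreeQNC0Three` BY NAME. -/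
theorem closes₂ (hA : HolAvoidLoss3) (hL : AvoidLift3) (hD : ExactnessDial.DPLift3) :
    Summit.QuantumAdvantage.AdviceFreeQNC0.AdviceFreeQNC0Three :=
  closes_T (hL hA) hD

/-- **the task dial (necessity chain)**: WIN ⟹ AVOID ⟹ SEPARATE ⟹ DECODE, each level a single-polynomial loss statement. -/
theorem dial_chain :
    (ExactnessDial.PolyLossOddU3 → HolAvoidLoss3) ∧ (HolAvoidLoss3 → BinPointerLoss3) ∧
      (BinPointerLoss3 → HolDecodeLoss3) :=
  ⟨holAvoidLoss3_of_polyLossOddU3, binPointerLoss3_of_holAvoidLoss3, holDecodeLoss3_of_binPointerLoss3⟩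

end Avoid

end HolonomyDial

end Summit.QuantumAdvantage.QuantumAdvantage.Theorems
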